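import Summits.CriticalPhenomena.CardyFormulaZ2.Theorems.CardyIKTransportIKLinearTransportPinnedDefs
import Mathlib.Analysis.Real.OfDigits

/-!
# Stub `stub_PinnedSampler` (line `pinned-diagram-exchange`, crux stmt-CriticalPhenomena-5076) —
# part U: i.i.d. UNIFORM levels out of the fresh bits `β`

Registered sub-goal `ps_beta_uniform` (a `--supports stmt-CriticalPhenomena-5076` helper): from the fresh
randomness `u : Rnd = Set (Site 2 × ℕ)` with law `β` (i.i.d. fair bits, countably many per cell) the binary
expansion `U v u = 0.b₀b₁b₂…`, `bₖ = [(v, k) ∈ u]`, is a measurable function of the bits AT THE CELL `v`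
only, is covariant under vertical shifts, and is UNIFORM: `β {U v ≤ c} = c` for `c ∈ [0,1]`. Proof: the
lexicographic event `{b <lex d}` is a disjoint union of cylinders of masses `dₙ 2^{-(n+1)}`, so
`β {b <lex d} = 0.d₀d₁…` (`Real.ofDigits`); with `d` the binary digits of `c` (`Real.digits`),
`{b <lex d} ⊆ {U ≤ c} ⊆ {b <lex d} ∪ {b = d}` and points are null. These levels feed the conditional
quantile transform of part T (`…StubPinnedSamplerTransfer.lean`).
-/

noncomputable section

namespace Summit.CriticalPhenomena.CardyFormulaZ2.Theorems.IKLinearTransport.PinnedDiagramExchange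

open scoped Classical MeasureTheory ENNReal ProbabilityTheory Topology NNReal BigOperators
open Set MeasureTheory ProbabilityTheory Filter
open Literature.Probability.Percolation Literature.Probability.LatticeModels

/-! ## Cylinder probabilities of `β` -/

/-- The fair Bernoulli law on `Prop` gives mass `1/2` to each truth value. [folklore] -/
theorem ps_bernoulliProp_half_setOf_iff (Q : Prop) :
    bernoulliProp half {q : Prop | q ↔ Q} = 2⁻¹ := by
  have hhalf : (unitInterval.toNNReal half : ℝ≥0∞) = 2⁻¹ := by
    have : unitInterval.toNNReal half = (2⁻¹ : ℝ≥0) := by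
      ext
      simp only [unitInterval.coe_toNNReal, coe_half, NNReal.coe_inv, NNReal.coe_ofNat]
      norm_num
    rw [this, ENNReal.coe_inv (by norm_num), ENNReal.coe_two]
  have hsymm : (unitInterval.toNNReal (unitInterval.symm half) : ℝ≥0∞) = 2⁻¹ := by
    have : unitInterval.toNNReal (unitInterval.symm half) = (2⁻¹ : ℝ≥0) := by
      ext
      simp only [unitInterval.coe_toNNReal, unitInterval.coe_symm_eq, coe_half, NNReal.coe_inv,
        NNReal.coe_ofNat]
      norm_num
    rw [this, ENNReal.coe_inv (by norm_num), ENNReal.coe_two]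
  by_cases hQ : Q
  · have hset : {q : Prop | q ↔ Q} = {True} := by
      ext q; simp only [mem_setOf_eq, mem_singleton_iff, hQ, iff_true, eq_iff_iff]
    rw [hset, bernoulliProp, bernoulliMeasure_apply_of_mem_of_notMem _ (measurableSet_singleton _)
      (by simp) (by simp), hhalf]
  · have hset : {q : Prop | q ↔ Q} = {False} := by
      ext q; simp only [mem_setOf_eq, mem_singleton_iff, hQ, iff_false, eq_iff_iff]
    rw [hset, bernoulliProp, bernoulliMeasure_apply_of_notMem_of_mem _ (measurableSet_singleton _)
      (by simp) (by simp), hsymm]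

/-- CYLINDERS: prescribing the first `m` bits at the cell `v` costs `2^{-m}` under `β`. [folklore] -/
theorem ps_beta_cylinder (v : Site 2) (m : ℕ) (P : ℕ → Prop) :
    β {u : Rnd | ∀ k < m, ((v, k) ∈ u ↔ P k)} = 2⁻¹ ^ m := by
  rw [show β = sitePercolation (Site 2 × ℕ) half from rfl, sitePercolation_apply']
  have hpre : (fun χ : Site 2 × ℕ → Prop => {w | χ w}) ⁻¹' {u : Rnd | ∀ k < m, ((v, k) ∈ u ↔ P k)} =
      Set.pi (↑((Finset.range m).image fun k => (v, k))) (fun w => {q : Prop | q ↔ P w.2}) := by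
    ext χ
    simp only [mem_preimage, mem_setOf_eq, Set.mem_pi, Finset.coe_image, Finset.coe_range]
    constructor
    · rintro h w ⟨k, hk, rfl⟩; exact h k hk
    · intro h k hk; exact h (v, k) ⟨k, hk, rfl⟩
  rw [hpre, sitePi, Measure.infinitePi_pi _ (fun w _ => MeasurableSpace.measurableSet_top)]
  simp_rw [ps_bernoulliProp_half_setOf_iff]
  rw [Finset.prod_const, Finset.card_image_of_injective _ (fun a b h => (Prod.mk.inj h).2),
    Finset.card_range]

/-- Points of the bit sequence at a cell are `β`-null. [folklore] -/
theorem ps_beta_bits_eq_null (v : Site 2) (d : ℕ → Fin 2) :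
    β {u : Rnd | (fun k => if (v, k) ∈ u then (1 : Fin 2) else 0) = d} = 0 := by
  have hle : ∀ N : ℕ, β {u : Rnd | (fun k => if (v, k) ∈ u then (1 : Fin 2) else 0) = d} ≤ 2⁻¹ ^ N := by
    intro N
    rw [← ps_beta_cylinder v N (fun k => d k = 1)]
    refine measure_mono fun u hu k _ => ?_
    have hk : (if (v, k) ∈ u then (1 : Fin 2) else 0) = d k := congrFun hu k
    by_cases h : (v, k) ∈ u
    · rw [if_pos h] at hk; simp [h, ← hk]
    · rw [if_neg h] at hk
      simp only [h, false_iff, ← hk]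
      exact Fin.zero_ne_one
  have ht := ENNReal.tendsto_pow_atTop_nhds_zero_of_lt_one ENNReal.one_half_lt_one
  exact le_antisymm (ge_of_tendsto' ht hle) zero_le

/-! ## The lexicographic event and the binary digits of the level -/

/-- `β {b <lex d} = 0.d₀d₁d₂…`: the lexicographic event is a disjoint union of cylinders. [folklore] -/
theorem ps_beta_lexLt (v : Site 2) (d : ℕ → Fin 2) :
    β {u : Rnd | ∃ n, (∀ k < n, (if (v, k) ∈ u then (1 : Fin 2) else 0) = d k) ∧
      (v, n) ∉ u ∧ d n = 1} = ENNReal.ofReal (Real.ofDigits d) := by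
  set E : ℕ → Set Rnd := fun n => {u | (∀ k < n, (if (v, k) ∈ u then (1 : Fin 2) else 0) = d k) ∧
    (v, n) ∉ u ∧ d n = 1} with hE
  have hEeq : ∀ n, E n = if d n = 1 then {u : Rnd | ∀ k < n + 1, ((v, k) ∈ u ↔ (k < n ∧ d k = 1))}
      else ∅ := by
    intro n
    split_ifs with hdn
    · ext u
      simp only [hE, mem_setOf_eq, hdn, and_true]
      constructor
      · rintro ⟨h1, h2⟩ k hk
        rcases Nat.lt_succ_iff_lt_or_eq.1 hk with hk | rfl
        · have := h1 k hk
          by_cases hvk : (v, k) ∈ u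
          · rw [if_pos hvk] at this; simp [hvk, hk, ← this]
          · rw [if_neg hvk] at this
            simp only [hvk, hk, true_and, false_iff, ← this]
            exact Fin.zero_ne_one
        · simp [h2]
      · intro h
        refine ⟨fun k hk => ?_, fun hn => ?_⟩
        · have := h k (Nat.lt_succ_of_lt hk)
          by_cases hvk : (v, k) ∈ u
          · rw [if_pos hvk]; exact ((this.1 hvk).2).symm
          · rw [if_neg hvk]
            have hdk : ¬ d k = 1 := fun hdk => hvk (this.2 ⟨hk, hdk⟩)
            rcases Fin.exists_fin_two.1 ⟨d k, rfl⟩ with h0 | h1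
            · exact h0.symm
            · exact absurd h1 hdk
        · exact lt_irrefl n ((h n (Nat.lt_succ_self n)).1 hn).1
    · ext u
      simp only [hE, mem_setOf_eq, mem_empty_iff_false, iff_false, not_and]
      exact fun _ _ => hdn
  have hmeasE : ∀ n, MeasurableSet (E n) := by
    intro n
    rw [hEeq n]
    split_ifs
    · exact measurableSet_setOf.2 (Measurable.forall fun k => Measurable.imp measurable_const
        ((measurable_set_mem _).iff measurable_const))
    · exact MeasurableSet.empty
  have hdisj : Pairwise (Function.onFun Disjoint E) := by
    intro m n hmn
    rcases lt_or_gt_of_ne hmn with h | h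
    · refine Set.disjoint_left.2 fun u hum hun => ?_
      have := hun.1 m h
      rw [if_neg hum.2.1] at this
      exact Fin.zero_ne_one (this.trans hum.2.2)
    · refine Set.disjoint_left.2 fun u hum hun => ?_
      have := hum.1 n h
      rw [if_neg hun.2.1] at this
      exact Fin.zero_ne_one (this.trans hun.2.2)
  have hmass : ∀ n, β (E n) = ENNReal.ofReal (Real.ofDigitsTerm d n) := by
    intro n
    rw [hEeq n]
    split_ifs with hdn
    · rw [ps_beta_cylinder]
      have : Real.ofDigitsTerm d n = (2⁻¹ : ℝ) ^ (n + 1) := by simp [Real.ofDigitsTerm, hdn]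
      rw [this, ENNReal.ofReal_pow (by norm_num), ENNReal.ofReal_inv_of_pos (by norm_num),
        ENNReal.ofReal_ofNat]
    · have : Real.ofDigitsTerm d n = 0 := by
        rcases Fin.exists_fin_two.1 ⟨d n, rfl⟩ with h0 | h1
        · simp [Real.ofDigitsTerm, h0]
        · exact absurd h1 hdn
      rw [this, ENNReal.ofReal_zero, measure_empty]
  have hunion : {u : Rnd | ∃ n, (∀ k < n, (if (v, k) ∈ u then (1 : Fin 2) else 0) = d k) ∧
      (v, n) ∉ u ∧ d n = 1} = ⋃ n, E n := by
    ext u; simp [hE]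
  rw [hunion, measure_iUnion hdisj hmeasE]
  simp_rw [hmass]
  rw [Real.ofDigits, ENNReal.ofReal_tsum_of_nonneg (fun _ => Real.ofDigitsTerm_nonneg)
    Real.summable_ofDigitsTerm]

/-- Lower inclusion: `b <lex digits c` forces `0.b₀b₁… ≤ c`. [folklore] -/
theorem ps_ofDigits_le_of_lexLt {c : ℝ} (hc : c ∈ Ico (0 : ℝ) 1) {b : ℕ → Fin 2} {n : ℕ}
    (hlt : ∀ k < n, b k = Real.digits c 2 k) (hb : b n = 0) (hd : Real.digits c 2 n = 1) :
    Real.ofDigits b ≤ c := by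
  set d : ℕ → Fin 2 := Real.digits c 2 with hdd
  have h1 : Real.ofDigits b ≤ ∑ i ∈ Finset.range (n + 1), Real.ofDigitsTerm b i +
      (((2 : ℕ) : ℝ) ^ (n + 1))⁻¹ := by
    rw [Real.ofDigits_eq_sum_add_ofDigits b (n + 1)]
    gcongr
    exact mul_le_of_le_one_right (by positivity) (Real.ofDigits_le_one _)
  have h2 : ∑ i ∈ Finset.range (n + 1), Real.ofDigitsTerm b i =
      ∑ i ∈ Finset.range n, Real.ofDigitsTerm d i := by
    rw [Finset.sum_range_succ]
    have : Real.ofDigitsTerm b n = 0 := by simp [Real.ofDigitsTerm, hb]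
    rw [this, add_zero]
    exact Finset.sum_congr rfl fun i hi => by
      simp only [Real.ofDigitsTerm, hlt i (Finset.mem_range.1 hi)]
  have h3 : ∑ i ∈ Finset.range n, Real.ofDigitsTerm d i + (((2 : ℕ) : ℝ) ^ (n + 1))⁻¹ =
      ∑ i ∈ Finset.range (n + 1), Real.ofDigitsTerm d i := by
    rw [Finset.sum_range_succ]
    congr 1
    simp [Real.ofDigitsTerm, hd]
  calc Real.ofDigits b ≤ _ := h1
    _ = ∑ i ∈ Finset.range (n + 1), Real.ofDigitsTerm d i := by rw [h2, h3]
    _ ≤ c := Real.sum_ofDigitsTerm_digits_le hc (n + 1)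

/-- Upper inclusion: `0.b₀b₁… ≤ c` forces `b <lex digits c` or `b = digits c`. [folklore] -/
theorem ps_lexLt_or_eq_of_ofDigits_le {c : ℝ} (hc : c ∈ Ico (0 : ℝ) 1) {b : ℕ → Fin 2}
    (hle : Real.ofDigits b ≤ c) :
    (∃ n, (∀ k < n, b k = Real.digits c 2 k) ∧ b n = 0 ∧ Real.digits c 2 n = 1) ∨
      b = Real.digits c 2 := by
  set d : ℕ → Fin 2 := Real.digits c 2 with hdd
  by_contra h
  have hne : b ≠ d := fun hbd => h (Or.inr hbd)
  have hnot : ∀ n, (∀ k < n, b k = d k) → b n = 0 → d n ≠ 1 := fun n h1 h2 h3 =>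
    h (Or.inl ⟨n, h1, h2, h3⟩)
  have hex : ∃ k, b k ≠ d k := Function.ne_iff.1 hne
  set n := Nat.find hex with hn
  have hbn : b n ≠ d n := Nat.find_spec hex
  have hmin : ∀ k < n, b k = d k := fun k hk => not_not.1 (Nat.find_min hex hk)
  have hb1 : b n = 1 ∧ d n = 0 := by
    rcases Fin.exists_fin_two.1 ⟨b n, rfl⟩ with hb0 | hb1
    · have hd1 : d n ≠ 1 := hnot n hmin hb0
      rcases Fin.exists_fin_two.1 ⟨d n, rfl⟩ with hd0 | hd1'
      · exact absurd (hb0.trans hd0.symm) hbn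
      · exact absurd hd1' hd1
    · rcases Fin.exists_fin_two.1 ⟨d n, rfl⟩ with hd0 | hd1'
      · exact ⟨hb1, hd0⟩
      · exact absurd (hb1.trans hd1'.symm) hbn
  -- the partial sums
  set S : ℝ := ∑ i ∈ Finset.range n, Real.ofDigitsTerm d i with hS
  have hSd : ∑ i ∈ Finset.range (n + 1), Real.ofDigitsTerm d i = S := by
    rw [Finset.sum_range_succ]; simp [Real.ofDigitsTerm, hb1.2, hS]
  have hSb : ∑ i ∈ Finset.range (n + 1), Real.ofDigitsTerm b i = S + (((2 : ℕ) : ℝ) ^ (n + 1))⁻¹ := by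
    rw [Finset.sum_range_succ]
    have : Real.ofDigitsTerm b n = (((2 : ℕ) : ℝ) ^ (n + 1))⁻¹ := by simp [Real.ofDigitsTerm, hb1.1]
    rw [this, hS]
    congr 1
    exact Finset.sum_congr rfl fun i hi => by
      simp only [Real.ofDigitsTerm, hmin i (Finset.mem_range.1 hi)]
  -- `c < S + 2^{-(n+1)}` from the floor formula for the digits
  have hfloor := Real.ofDigits_digits_sum_eq (b := 2) hc (n + 1)
  rw [← hdd, hSd] at hfloor
  have hpos : (0 : ℝ) < ((2 : ℕ) : ℝ) ^ (n + 1) := by positivity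
  have hclt : c < S + (((2 : ℕ) : ℝ) ^ (n + 1))⁻¹ := by
    have h1 : ((2 : ℕ) : ℝ) ^ (n + 1) * c < S * ((2 : ℕ) : ℝ) ^ (n + 1) + 1 := by
      have := Nat.lt_floor_add_one (((2 : ℕ) : ℝ) ^ (n + 1) * c)
      push_cast at hfloor this ⊢
      rw [← hfloor] at this
      linarith
    have h2 : S + (((2 : ℕ) : ℝ) ^ (n + 1))⁻¹ = (S * ((2 : ℕ) : ℝ) ^ (n + 1) + 1) / ((2 : ℕ) : ℝ) ^ (n + 1) := by
      field_simp
    rw [h2, lt_div_iff₀ hpos]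
    linarith
  -- `S + 2^{-(n+1)} ≤ ofDigits b`
  have hge : S + (((2 : ℕ) : ℝ) ^ (n + 1))⁻¹ ≤ Real.ofDigits b := by
    rw [← hSb, Real.ofDigits]
    exact Real.summable_ofDigitsTerm.sum_le_tsum _ fun i _ => Real.ofDigitsTerm_nonneg
  linarith

/-! ## The uniform levels -/

/-- I.I.D. UNIFORM LEVELS FROM THE FRESH BITS: `U v u = 0.b₀b₁…` with `bₖ = [(v,k) ∈ u]` is measurable,
reads only the bits at the cell `v`, is covariant under vertical shifts, and is uniform on `[0,1]` under
`β`: `β {U v ≤ c} = c` for every `c ∈ [0,1]`. [folklore] -/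
theorem ps_beta_uniform :
    ∃ U : Site 2 → Rnd → ℝ, (∀ v, Measurable (U v)) ∧
      (∀ v (u u' : Rnd), (∀ k : ℕ, ((v, k) ∈ u ↔ (v, k) ∈ u')) → U v u = U v u') ∧
      (∀ v (m : ℤ) (u : Rnd), U v (ushift m u) = U (v - ![0, m]) u) ∧
      ∀ v, ∀ c ∈ Set.Icc (0 : ℝ) 1, β {u | U v u ≤ c} = ENNReal.ofReal c := by
  set bits : Site 2 → Rnd → ℕ → Fin 2 := fun v u k => if (v, k) ∈ u then 1 else 0 with hbits
  have hbm : ∀ v, Measurable (bits v) := fun v =>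
    measurable_pi_lambda _ fun k => Measurable.ite (measurableSet_mem (v, k)) measurable_const
      measurable_const
  refine ⟨fun v u => Real.ofDigits (bits v u), fun v => Real.continuous_ofDigits.measurable.comp (hbm v),
    fun v u u' h => ?_, fun v m u => ?_, fun v c hc => ?_⟩
  · dsimp only
    congr 1
    funext k
    simp only [hbits, h k]
  · dsimp only
    congr 1
  · haveI : IsProbabilityMeasure β := by
      rw [show β = sitePercolation (Site 2 × ℕ) half from rfl]; infer_instance
    rcases eq_or_lt_of_le hc.2 with rfl | hc1
    · have : {u : Rnd | Real.ofDigits (bits v u) ≤ 1} = univ :=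
        eq_univ_of_forall fun u => Real.ofDigits_le_one _
      simp only [this, measure_univ, ENNReal.ofReal_one]
    have hc' : c ∈ Ico (0 : ℝ) 1 := ⟨hc.1, hc1⟩
    refine le_antisymm ?_ ?_
    · calc β {u : Rnd | Real.ofDigits (bits v u) ≤ c}
          ≤ β ({u : Rnd | ∃ n, (∀ k < n, (if (v, k) ∈ u then (1 : Fin 2) else 0) = Real.digits c 2 k) ∧
              (v, n) ∉ u ∧ Real.digits c 2 n = 1} ∪
              {u : Rnd | (fun k => if (v, k) ∈ u then (1 : Fin 2) else 0) = Real.digits c 2}) := by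
            refine measure_mono fun u hu => ?_
            rcases ps_lexLt_or_eq_of_ofDigits_le hc' hu with ⟨n, h1, h2, h3⟩ | h
            · refine Or.inl ⟨n, h1, fun hvn => ?_, h3⟩
              have : bits v u n = 1 := by simp only [hbits, if_pos hvn]
              exact Fin.zero_ne_one (h2.symm.trans this)
            · exact Or.inr h
        _ ≤ _ := measure_union_le _ _
        _ = ENNReal.ofReal c := by
            rw [ps_beta_lexLt, ps_beta_bits_eq_null, add_zero, Real.ofDigits_digits one_lt_two hc']
    · calc ENNReal.ofReal c = β {u : Rnd | ∃ n, (∀ k < n, (if (v, k) ∈ u then (1 : Fin 2) else 0) =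
            Real.digits c 2 k) ∧ (v, n) ∉ u ∧ Real.digits c 2 n = 1} := by
            rw [ps_beta_lexLt, Real.ofDigits_digits one_lt_two hc']
        _ ≤ β {u : Rnd | Real.ofDigits (bits v u) ≤ c} := by
            refine measure_mono fun u hu => ?_
            obtain ⟨n, h1, h2, h3⟩ := hu
            exact ps_ofDigits_le_of_lexLt hc' h1 (by simp only [hbits, if_neg h2]) h3

end Summit.CriticalPhenomena.CardyFormulaZ2.Theorems.IKLinearTransport.PinnedDiagramExchange
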